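import Summits.Ventures.PercRepro.S1Kill

/-!
# PercRepro — THE KILL LEVER AT EVERY LEVEL `q` (p2, gen 22; SUBCLAIM-S1 §6.6 (ii); a service module for S2 / S3)

The `q = 4` lever of S1Kill, unscaled and at every level: on a finite matroid the sets of size `q + 1 … p − 1`
together with the `p`-sets through the circuits of a family `𝒯` are `Y(p, q)`-sets (`q < r < p`) unless of rank
`≤ q` (then they are sets of size `≥ q + 1` and rank `≤ q` — the `low` budget); the `p`-sets through a circuit of
size `k` number `C(n − k, p − k)`, two of the families overlap in `≤ C(n − u, p − u)` sets once the two circuits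
cover `≥ u` points (Bonferroni). No core hypothesis at all: only `[M.Finite]`.

* **`sum_choose_add_kill_le_midCount_add_low`** — for `q + 1 ≤ p`: `Σ_{j=q+1}^{p−1} C(n, j) + m·C(n − k, p − k) ≤
  #Y(p, q) + #{A ⊆ E : q + 1 ≤ |A|, r(A) ≤ q} + C(m, 2)·C(n − u, p − u)`.
Axioms: standard.
-/

open scoped Matroid

namespace PercRepro

namespace S1

open Set

variable {α : Type}

/-- **THE KILL LEVER AT LEVEL `q`** (no core hypothesis; `q + 1 ≤ p`): for a family `𝒯` of `m` circuits of size
`k ≤ p`, any two covering `≥ u` points (`u ≤ p`),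
`Σ_{j=q+1}^{p−1} C(n, j) + m·C(n − k, p − k) ≤ #Y(p, q) + #{A ⊆ E : q + 1 ≤ |A| ∧ r(A) ≤ q} + C(m, 2)·C(n − u, p − u)`. -/
theorem sum_choose_add_kill_le_midCount_add_low (M : Matroid α) [M.Finite] (p q : ℕ) (hqp : q + 1 ≤ p)
    (k : ℕ) (hkp : k ≤ p) (u : ℕ) (hup : u ≤ p) (𝒯 : Finset (Set α))
    (h𝒯 : ∀ C ∈ 𝒯, M.IsCircuit C ∧ C.ncard = k)
    (hpair : ∀ C ∈ 𝒯, ∀ C' ∈ 𝒯, C ≠ C' → u ≤ (C ∪ C').ncard) :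
    ∑ j ∈ Finset.Ico (q + 1) p, M.E.ncard.choose j + 𝒯.card * (M.E.ncard - k).choose (p - k) ≤
      Matroid.midCount M p q + {A : Set α | A ⊆ M.E ∧ q + 1 ≤ A.ncard ∧ M.eRk A ≤ q}.ncard +
      𝒯.card.choose 2 * (M.E.ncard - u).choose (p - u) := by
  classical
  have hEfin : M.E.Finite := M.ground_finite
  set Ef := hEfin.toFinset with hEf
  -- the sets with `q + 1 ≤ |A| ≤ p − 1`
  set 𝓑 : ℕ → Finset (Set α) := fun j => (Ef.powersetCard j).image (fun s : Finset α => (s : Set α)) with h𝓑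
  have h𝓑card : ∀ j, (𝓑 j).card = M.E.ncard.choose j := fun j => by
    rw [h𝓑]; exact card_image_powersetCard hEfin j
  have hmem𝓑 : ∀ j A, A ∈ 𝓑 j ↔ A ⊆ M.E ∧ A.ncard = j := fun j A =>
    mem_image_powersetCard_iff hEfin j A
  have hdisj : ((Finset.Ico (q + 1) p : Finset ℕ) : Set ℕ).PairwiseDisjoint 𝓑 := by
    intro i _ j _ hij
    rw [Function.onFun, Finset.disjoint_left]
    intro A hA hA'
    rw [hmem𝓑] at hA hA'
    exact hij (hA.2.symm.trans hA'.2)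
  set W := (Finset.Ico (q + 1) p).biUnion 𝓑 with hW
  have hWcard : W.card = ∑ j ∈ Finset.Ico (q + 1) p, M.E.ncard.choose j := by
    rw [hW, Finset.card_biUnion hdisj]
    exact Finset.sum_congr rfl (fun j _ => h𝓑card j)
  have hmemW : ∀ A ∈ W, A ⊆ M.E ∧ q + 1 ≤ A.ncard ∧ A.ncard < p := by
    intro A hA
    rw [hW, Finset.mem_biUnion] at hA
    obtain ⟨j, hj, hAj⟩ := hA
    rw [Finset.mem_Ico] at hj
    rw [hmem𝓑] at hAj
    exact ⟨hAj.1, by omega, by omega⟩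
  -- the kill
  set Kf : Set α → Finset (Set α) := fun C => oversets hEfin C (p - k) with hKf
  set KK := 𝒯.biUnion Kf with hKK
  have hmemK : ∀ A ∈ KK, A ⊆ M.E ∧ A.ncard = p ∧ ∃ C ∈ 𝒯, C ⊆ A := by
    intro A hA
    rw [hKK, Finset.mem_biUnion] at hA
    obtain ⟨C, hC, hAC⟩ := hA
    have hCE : C ⊆ M.E := (h𝒯 C hC).1.subset_ground
    have hcard := ncard_of_mem_oversets hEfin hCE (p - k) hAC
    rw [hKf] at hAC
    rw [mem_oversets hEfin hCE] at hAC
    refine ⟨hAC.2.1, ?_, C, hC, hAC.1⟩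
    rw [hcard, (h𝒯 C hC).2]
    omega
  have hKcard : 𝒯.card * (M.E.ncard - k).choose (p - k) ≤
      KK.card + 𝒯.card.choose 2 * (M.E.ncard - u).choose (p - u) := by
    refine mul_le_card_biUnion_add_choose_two_mul 𝒯 Kf _ _ ?_ ?_
    · intro C hC
      have hCE : C ⊆ M.E := (h𝒯 C hC).1.subset_ground
      rw [hKf]
      simp only
      rw [card_oversets hEfin hCE, (h𝒯 C hC).2]
    · intro C hC C' hC' hne
      have hCE : C ⊆ M.E := (h𝒯 C hC).1.subset_ground
      have hC'E : C' ⊆ M.E := (h𝒯 C' hC').1.subset_ground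
      have h5 := hpair C hC C' hC' hne
      obtain ⟨X, hXsub, hXu⟩ := Set.exists_subset_card_eq h5
      have hXE : X ⊆ M.E := hXsub.trans (Set.union_subset hCE hC'E)
      have hsub : Kf C ∩ Kf C' ⊆ oversets hEfin X (p - u) := by
        intro Q hQ
        rw [Finset.mem_inter] at hQ
        have hQcard := ncard_of_mem_oversets hEfin hCE (p - k) hQ.1
        rw [hKf] at hQ
        simp only at hQ
        rw [mem_oversets hEfin hCE] at hQ
        have hQ2 := hQ.2
        rw [mem_oversets hEfin hC'E] at hQ2
        rw [mem_oversets hEfin hXE]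
        refine ⟨hXsub.trans (Set.union_subset hQ.1.1 hQ2.1), hQ.1.2.1, ?_⟩
        have hQfin : Q.Finite := hEfin.subset hQ.1.2.1
        have hXQ : X ⊆ Q := hXsub.trans (Set.union_subset hQ.1.1 hQ2.1)
        rw [Set.ncard_sdiff hXQ (hQfin.subset hXQ), hQcard, (h𝒯 C hC).2, hXu]
        omega
      calc (Kf C ∩ Kf C').card ≤ (oversets hEfin X (p - u)).card := Finset.card_le_card hsub
        _ = (M.E.ncard - u).choose (p - u) := by rw [card_oversets hEfin hXE, hXu]
  -- `W ∪ KK ⊆ Y ∪ L`, disjoint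
  set Y := {A : Set α | A ⊆ M.E ∧ (q : ℕ∞) < M.eRk A ∧ M.eRk A < (p : ℕ∞)} with hY
  set L := {A : Set α | A ⊆ M.E ∧ q + 1 ≤ A.ncard ∧ M.eRk A ≤ q} with hL
  have hclass : ∀ A, A ⊆ M.E → q + 1 ≤ A.ncard → M.eRk A < (p : ℕ∞) → A ∈ Y ∪ L := by
    intro A hAE hq hlt
    by_cases h : (q : ℕ∞) < M.eRk A
    · exact Or.inl ⟨hAE, h, hlt⟩
    · push Not at h
      exact Or.inr ⟨hAE, hq, h⟩
  have hsub : ((W ∪ KK : Finset (Set α)) : Set (Set α)) ⊆ Y ∪ L := by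
    intro A hA
    rw [Finset.mem_coe, Finset.mem_union] at hA
    rcases hA with hA | hA
    · obtain ⟨hAE, hq, hlt⟩ := hmemW A hA
      have hAfin : A.Finite := hEfin.subset hAE
      refine hclass A hAE hq ?_
      calc M.eRk A ≤ A.encard := M.eRk_le_encard A
        _ = (A.ncard : ℕ∞) := hAfin.cast_ncard_eq.symm
        _ < (p : ℕ∞) := by exact_mod_cast hlt
    · obtain ⟨hAE, hAp, C, hC, hCA⟩ := hmemK A hA
      have hq : q + 1 ≤ A.ncard := by rw [hAp]; exact hqp
      exact hclass A hAE hq (eRk_lt_of_circuit_subset M (h𝒯 C hC).1 hCA hAE hAp)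
  have hWK : Disjoint W KK := by
    rw [Finset.disjoint_left]
    intro A hAW hAK
    have h1 := (hmemW A hAW).2.2
    have h2 := (hmemK A hAK).2.1
    omega
  have hYfin : Y.Finite := hEfin.finite_subsets.subset (fun A hA => hA.1)
  have hLfin : L.Finite := hEfin.finite_subsets.subset (fun A hA => hA.1)
  have hWle : W.card + KK.card ≤ Y.ncard + L.ncard := by
    calc W.card + KK.card = (W ∪ KK).card := (Finset.card_union_of_disjoint hWK).symm
      _ = ((W ∪ KK : Finset (Set α)) : Set (Set α)).ncard := (Set.ncard_coe_finset _).symm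
      _ ≤ (Y ∪ L).ncard := Set.ncard_le_ncard hsub (hYfin.union hLfin)
      _ ≤ Y.ncard + L.ncard := Set.ncard_union_le _ _
  have hmid : Matroid.midCount M p q = Y.ncard := rfl
  rw [← hWcard, hmid]
  omega

end S1

end PercRepro
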